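import Literature.NumberTheory.Automorphic.Liu2021.Def411WeilCarriersIrreducibleOfLemD1
import HarnessLib

/-!
# Admissibility of the Weil `χ`-coinvariants `Ω(s, χ')` of a unitary dual pair `U(V) × U(⟨a⟩)`, from the place-assembled `Ω`

Topic `NumberTheory/GelbartRogawski1991` (sequel of `UnitaryDualPairWeilCoinvariants*.lean`,
`FiniteAdelicWeilCentralCoinvariantsIrreducible.lean`, `Liu2021/Def411WeilCarriersIrreducibleOf{Local,LemD1}.lean`).
Theorems only (no definition, no record, no named fact, no `sorry`).  [Liu2021, Def. 4.11 (l. 2092–2096)] calls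
`ω(μ, ε, χ) := ⊗'_v ω(μ_v, ε_v, χ_v)` «an irreducible ADMISSIBLE representation»; the tree proves «irreducible» for its
Weil-coinvariant carrier by a chain of comparison maps (`isIrreducible_weilCoinv_iff_omega_center`,
`omega_center_isIrreducible_of_local`, Flath).  This file reads the same chain with `Representation.IsAdmissible` for
`IsIrreducible`: every comparison map is an equivariant linear bijection along a CONTINUOUS OPEN homomorphism, so
«finite-dimensional fixed vectors under compact open subgroups» is transported too — the one new topological input being
that for a hermitian LINE `W = ⟨a⟩` the `V`-member `k ↦ reindex e e (k ⊗ₖ 1) : U(J_V)(𝔸_{F,f}) → U(J_V ⊗ (a))(𝔸_{F,f})` is OPEN.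
§0 `UnitaryGroup.isOpenMap_finPairEmb_inl_of_line`; §1 generic transports (`Representation.IsAdmissible.comp_of_continuous_of_isOpenMap`,
`TwistedCoinv.isAdmissible_rep_{iff_of_comp_surjective_right, comp_of_isOpenMap, iff_of_mapEquiv}` — twins of
`TwistedCoinvariantsIrreducible.lean`); §2 `FinLocalSplittings.omega_centralCoinv_isAdmissible_of_omegaPi`,
`WeilCoinv.omega_center_isAdmissible_of_omegaPi`, `WeilCoinv.isAdmissible_weilCoinv_of_omega_center`, the `⊗′`-level
admissibility ([Flath1979, §2 Example 2]) entering as a HYPOTHESIS.  Nothing of [Liu2021] is asserted.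

References: [Liu2021] Y. Liu, Camb. J. Math. 9 (2021) = arXiv:2102.11518, Def. 4.11, App. D §D.1 Step 3 (l. 5221);
[GelbartRogawski1991] S. Gelbart, J. Rogawski, Invent. Math. 105 (1991), §3.1 Prop. 3.1.1 p. 455, Remark p. 457, §3.2
p. 457; [BernsteinZelevinsky1976] Russian Math. Surveys 31 (1976), Def. 2.1; [Flath1979] PSPM 33 (1979) part 1, §2 Ex. 2.
-/

set_option autoImplicit false
noncomputable section

open scoped Matrix Kronecker TensorProduct Classical RestrictedProduct
open NumberField NumberField.mixedEmbedding IsDedekindDomain Filter Set Literature.NumberTheory.Automorphic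
open Literature.NumberTheory.Automorphic.UnitaryGroup Literature.NumberTheory.Weil1964 Literature.RepresentationTheory

/-! ## §0 For a line `W`, `k ↦ reindex e e (k ⊗ₖ 1) : U(J_V)(𝔸_{F,f}) → U(J_{VW})(𝔸_{F,f})` is an open embedding onto -/
namespace Literature.NumberTheory.Automorphic.UnitaryGroup

variable (F E : Type) [Field F] [NumberField F] [Field E] [NumberField E] [Algebra F E]
variable (c : E ≃ₐ[F] E) (N : ℕ) {n : ℕ} (e : Fin N × Fin 1 ≃ Fin n)
variable (JV : Matrix (Fin N) (Fin N) E) (JW : Matrix (Fin 1) (Fin 1) E)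

omit [NumberField F] in
/-- the entries of `reindex e e (k ⊗ₖ 1)` at `(e (i, 0), e (j, 0))` are the entries of `k`.
[cite: GelbartRogawski1991, §3.2 p. 457] -/
theorem coe_finPairEmb_inl_apply (k : finAdelic F E c N JV) (i j : Fin N) :
    ((finPairEmb F E c N 1 e JV JW (k, 1) : finAdelic F E c n (Matrix.reindex e e (JV ⊗ₖ JW))) :
        GL (Fin n) (FiniteAdeleRing (𝓞 E) E)).1 (e (i, 0)) (e (j, 0)) =
      (k : GL (Fin N) (FiniteAdeleRing (𝓞 E) E)).1 i j := by
  change (reindexGL e (kroneckerGL ((k : GL (Fin N) (FiniteAdeleRing (𝓞 E) E)),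
      ((1 : finAdelic F E c 1 JW) : GL (Fin 1) (FiniteAdeleRing (𝓞 E) E)))) : GL (Fin n) (FiniteAdeleRing (𝓞 E) E)).1
    (e (i, 0)) (e (j, 0)) = _
  simp [Matrix.kroneckerMap_apply]

omit [NumberField F] in
/-- **for any `J_W`, the `V`-member `k ↦ reindex e e (k ⊗ₖ 1)` of `finPairEmb` is injective** (its entries at
`(e (i, 0), e (j, 0))` are those of `k`). [cite: GelbartRogawski1991, §3.2 p. 457] -/
theorem finPairEmb_inl_injective :
    Function.Injective ((finPairEmb F E c N 1 e JV JW).comp (MonoidHom.inl _ _)) := by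
  intro k k' h
  refine Subtype.ext (Units.ext (Matrix.ext fun i j => ?_))
  rw [← coe_finPairEmb_inl_apply F E c N e JV JW k i j, ← coe_finPairEmb_inl_apply F E c N e JV JW k' i j]
  exact congrArg (fun G : finAdelic F E c n (Matrix.reindex e e (JV ⊗ₖ JW)) =>
    (G : GL (Fin n) (FiniteAdeleRing (𝓞 E) E)).1 (e (i, 0)) (e (j, 0))) h

omit [NumberField F] in
/-- **For a hermitian LINE `W` (`J_W = (a)`, `a ≠ 0`), `k ↦ reindex e e (k ⊗ₖ 1) : U(J_V)(𝔸_{F,f}) → U(J_{VW})(𝔸_{F,f})` is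
an OPEN map** (a homeomorphic isomorphism `U(V) ≅ U(V ⊗ ⟨a⟩)`: a continuous bijection — `continuous_finPairEmb`,
`finPairEmb_inl_injective`, `finPairEmb_inl_surjective_of_line` — whose inverse reads off the entries `G_{e(i,0), e(j,0)}`
of `G` and `G⁻¹`). [cite: GelbartRogawski1991, §3.2 p. 457; Liu2021, App. D §D.1 Steps 1–2 (l. 5214–5219)] -/
theorem isOpenMap_finPairEmb_inl_of_line (hJW : JW 0 0 ≠ 0) :
    IsOpenMap ((finPairEmb F E c N 1 e JV JW).comp (MonoidHom.inl _ _)) := by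
  -- the group isomorphism `Φ : U(J_V)(𝔸_f) ≃* U(J_{VW})(𝔸_f)`
  let Φ : finAdelic F E c N JV ≃* finAdelic F E c n (Matrix.reindex e e (JV ⊗ₖ JW)) :=
    MulEquiv.ofBijective ((finPairEmb F E c N 1 e JV JW).comp (MonoidHom.inl _ _))
      ⟨finPairEmb_inl_injective F E c N e JV JW, fun G => finPairEmb_inl_surjective_of_line F E c N JV e JW hJW G⟩
  have hΦ : ∀ k, Φ k = finPairEmb F E c N 1 e JV JW (k, 1) := fun _ => rfl
  -- entries of the inverse and of its pointwise inverse; continuity of the inverse for the unit-group topology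
  have hval : ∀ (G : finAdelic F E c n (Matrix.reindex e e (JV ⊗ₖ JW))) (i j : Fin N),
      (Φ.symm G : GL (Fin N) (FiniteAdeleRing (𝓞 E) E)).1 i j =
        (G : GL (Fin n) (FiniteAdeleRing (𝓞 E) E)).1 (e (i, 0)) (e (j, 0)) := fun G i j => by
    conv_rhs => rw [← Φ.apply_symm_apply G, hΦ]
    rw [coe_finPairEmb_inl_apply]
  have hinv : ∀ (G : finAdelic F E c n (Matrix.reindex e e (JV ⊗ₖ JW))) (i j : Fin N),
      ((Φ.symm G : GL (Fin N) (FiniteAdeleRing (𝓞 E) E))⁻¹).1 i j =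
        ((G : GL (Fin n) (FiniteAdeleRing (𝓞 E) E))⁻¹).1 (e (i, 0)) (e (j, 0)) := fun G i j => by
    rw [← Subgroup.coe_inv, ← map_inv, hval, Subgroup.coe_inv]
  refine IsOpenMap.of_inverse (continuous_induced_rng.2 (Units.continuous_iff.2
    ⟨continuous_matrix fun i j => ?_, continuous_matrix fun i j => ?_⟩)) Φ.apply_symm_apply Φ.symm_apply_apply
  · simp only [Function.comp_apply, hval]
    exact (Units.continuous_val.comp continuous_subtype_val).matrix_elem (e (i, 0)) (e (j, 0))
  · simp only [Function.comp_apply, hinv]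
    exact (Units.continuous_coe_inv.comp continuous_subtype_val).matrix_elem (e (i, 0)) (e (j, 0))

omit [NumberField F] in
/-- continuity of the `V`-member `k ↦ reindex e e (k ⊗ₖ 1)` of `finPairEmb`. [cite: GelbartRogawski1991, §3.2 p. 457] -/
theorem continuous_finPairEmb_inl : Continuous ((finPairEmb F E c N 1 e JV JW).comp (MonoidHom.inl _ _)) :=
  (continuous_finPairEmb F E c N 1 e JV JW).comp (continuous_id.prodMk continuous_const)

end Literature.NumberTheory.Automorphic.UnitaryGroup

/-! ## §1 Admissibility of the action on `χ`-coinvariants: generic transports -/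

namespace Representation

variable {k L L' V : Type*} [CommRing k] [Group L] [Group L'] [AddCommGroup V] [Module k V]
  [TopologicalSpace L] [TopologicalSpace L']

/-- **Composing with a CONTINUOUS OPEN homomorphism `Θ : L' →* L` preserves admissibility** (stabilisers are preimages;
the vectors fixed by a compact open `K' ≤ L'` under `ρ ∘ Θ` are those fixed by the compact open `Θ(K')` under `ρ`).  The
`MonoidHom` (dot-notation) form of the tree's `IsAdmissible.of_equivariant_mulEquiv` ∕
`Literature.NumberTheory.Automorphic.IsAdmissible.comp_of_isOpenMap` (`ParabolicGLReindex.lean`), restated over a commutative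
ring so that the Weil-representation lane need not import the parabolic-induction files; a deliberate dot-notation extension
of `Representation.IsAdmissible`. [cite: BernsteinZelevinsky1976, Definition 2.1(b)] -/
theorem IsAdmissible.comp_of_continuous_of_isOpenMap {ρ : Representation k L V} (hρ : ρ.IsAdmissible) (Θ : L' →* L)
    (hΘc : Continuous Θ) (hΘo : IsOpenMap Θ) : IsAdmissible (ρ.comp Θ) := by
  refine ⟨fun v => (hρ.isSmooth v).preimage hΘc, fun K hK => ?_⟩
  haveI : Module.Finite k (ρ.fixedPoints ((K : Subgroup L').map Θ)) :=
    hρ.finite_fixedPoints ⟨(K : Subgroup L').map Θ, hΘo _ K.isOpen⟩ (hK.image hΘc)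
  have heq : fixedPoints (ρ.comp Θ) (K : Subgroup L') = ρ.fixedPoints ((K : Subgroup L').map Θ) := by
    ext v
    simp only [mem_fixedPoints, Subgroup.mem_map, forall_exists_index, and_imp, forall_apply_eq_imp_iff₂]
    rfl
  rw [heq]
  infer_instance

end Representation

namespace Literature.RepresentationTheory.TwistedCoinv

variable {k : Type*} [Field k] {G G' H H' S S' : Type*} [Group G] [Group G'] [Group H] [Group H']
  [AddCommGroup S] [Module k S] [AddCommGroup S'] [Module k S'] [TopologicalSpace G] [TopologicalSpace G']

/-- **Pulling the acting group back along a SURJECTIVE `ζ : H' →* H` does not change the admissibility of the `G`-action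
on the coinvariants** (`Coinv (ρW ∘ ζ) (χ ∘ ζ)`, `Coinv ρW χ` are quotients by the same submodule, `ker_comp_of_surjective`;
twin of `isIrreducible_rep_iff_of_comp_surjective_right`). [cite: BernsteinZelevinsky1976, Definition 2.1(b)] -/
theorem isAdmissible_rep_iff_of_comp_surjective_right (ρW : Representation k H S) (χ : H →* kˣ)
    (ζ : H' →* H) (hζ : Function.Surjective ζ) (ρV : Representation k G S)
    (hc : ∀ (g : G) (h : H), Commute (ρV g) (ρW h))
    (hc' : ∀ (g : G) (h' : H'), Commute (ρV g) ((show Representation k H' S from ρW.comp ζ) h')) :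
    (rep (χ.comp ζ) ρV hc').IsAdmissible ↔ (rep χ ρV hc).IsAdmissible :=
  Representation.isAdmissible_iff_of_equivariant _ _
    (Submodule.quotEquivOfEq _ _ (ker_comp_of_surjective ρW χ ζ hζ)) fun g x => by
      obtain ⟨v, rfl⟩ := mk_surjective _ (χ.comp ζ) x
      rfl

/-- **Pulling the `G`-action back along a CONTINUOUS OPEN homomorphism `f : G' →* G` preserves admissibility of the
coinvariant representation** (`rep χ (ρV ∘ f) = (rep χ ρV) ∘ f` by `rep_comp_apply`, then
`IsAdmissible.comp_of_continuous_of_isOpenMap`). [cite: BernsteinZelevinsky1976, Definition 2.1(b)] -/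
theorem isAdmissible_rep_comp_of_isOpenMap (ρW : Representation k H S) (χ : H →* kˣ)
    (ρV : Representation k G S) (hc : ∀ (g : G) (h : H), Commute (ρV g) (ρW h)) (f : G' →* G)
    (hf : Continuous f) (hfo : IsOpenMap f)
    (hc' : ∀ (g' : G') (h : H), Commute ((show Representation k G' S from ρV.comp f) g') (ρW h))
    (h : (rep χ ρV hc).IsAdmissible) :
    (rep χ (show Representation k G' S from ρV.comp f) hc').IsAdmissible := by
  have heq : rep χ (show Representation k G' S from ρV.comp f) hc' = (rep χ ρV hc).comp f :=
    MonoidHom.ext fun g' => rep_comp_apply ρW χ ρV hc f hc' g'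
  rw [heq]
  exact h.comp_of_continuous_of_isOpenMap f hf hfo

/-- **Admissibility of the `G`-action on `χ`-coinvariants is transported along `mapEquiv`** (same group `G`, no scalars on
the `G`-side): for `T : S ≃ₗ S'` with `ρW' h (T v) = e h • T (ρW h v)`, `χ' = e·χ`, `ρV' g (T v) = T (ρV g v)`, `rep χ ρV` is
admissible iff `rep χ' ρV'` is (twin of `isIrreducible_rep_iff_of_mapEquiv` at `φ = id`, `a = 1`). [cite: BernsteinZelevinsky1976, Definition 2.1(b)] -/
theorem isAdmissible_rep_iff_of_mapEquiv (ρW : Representation k H S) (χ : H →* kˣ) (ρW' : Representation k H S')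
    (χ' : H →* kˣ) (ρV : Representation k G S) (ρV' : Representation k G S')
    (hc : ∀ (g : G) (h : H), Commute (ρV g) (ρW h)) (hc' : ∀ (g : G) (h : H), Commute (ρV' g) (ρW' h))
    (T : S ≃ₗ[k] S') (e : H → kˣ) (hT : ∀ (h : H) (v : S), ρW' h (T v) = ((e h : kˣ) : k) • T (ρW h v))
    (hχ : ∀ h : H, χ' h = e h * χ h) (hg : ∀ (g : G) (v : S), ρV' g (T v) = T (ρV g v)) :
    (rep χ ρV hc).IsAdmissible ↔ (rep χ' ρV' hc').IsAdmissible :=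
  Representation.isAdmissible_iff_of_equivariant _ _ (mapEquiv ρW χ ρW' χ' T e hT hχ) fun g x => by
    rw [mapEquiv_rep ρW χ ρW' χ' ρV ρV' hc hc' T e hT hχ (g := g) (g' := g) (a := (1 : k))
      (fun v => by rw [one_smul]; exact hg g v) x, one_smul]

end Literature.RepresentationTheory.TwistedCoinv

/-! ## §2 The place-assembled `Ω`: admissibility of the central coinvariants, down to `Ω(s, χ')` -/

namespace Literature.NumberTheory.GelbartRogawski1991.UnitaryDualPair.LocalSplitting.FinLocalSplittings

universe uH

variable {F : Type} [Field F] [NumberField F] {E : Type} [Field E] [NumberField E] [Algebra F E]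
  [Algebra.IsQuadraticExtension F E] {c : E ≃ₐ[F] E} {N : ℕ} {δ : E} {hcδ : c δ = -δ} {hδ : δ ≠ 0} {d : F}
  {hd : δ * δ = algebraMap F E d} {T : Matrix (Fin N) (Fin N) F} {hT : T.IsSymm}
  {J : Matrix (Fin N) (Fin N) E} {hJ : J = T.map (algebraMap F E)}
  (𝓢 : FinLocalSplittings F E c N hcδ hδ hd T hT hJ)
  {H : HeightOneSpectrum (𝓞 F) → Type uH} [∀ v, Group (H v)] {KH : ∀ v, Subgroup (H v)}
  (φ : ∀ v, H v →* UnitaryGroup.localPi E c N J v)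
  (hφ : ∀ᶠ v in cofinite, MapsTo (φ v) (KH v) (UnitaryGroup.localInt E c N J v))

/-- **Admissibility of the central coinvariants read on `U(J)(𝔸_{F,f})` and on any group `W` mapping onto
`Πʳ_v [H_v, KH_v]`** (admissibility twin of `omega_centralCoinv_isIrreducible`, the `⊗′`-level admissibility —
[Flath1979, §2 Example 2] — being the HYPOTHESIS `hadmPi`): along `Ω = 𝓢.OmegaPi ∘ finAdelicEquiv` (a topological group
isomorphism) and a surjection `ζ : W →* Πʳ_v [H_v, KH_v]`, IF `Coinv(Ω_Π ∘ Πʳφ, χ)` is admissible for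
`Πʳ_v [U(J)(F_v), U(J)(𝒪_v)]` THEN `Coinv(Ω_Π ∘ Πʳφ ∘ ζ, χ ∘ ζ)` is admissible for `U(J)(𝔸_{F,f})`.
[cite: Flath1979, §2 Example 2; Liu2021, Def. 4.11 (l. 2092–2096)] -/
theorem omega_centralCoinv_isAdmissible_of_omegaPi
    (hcomm : ∀ (g : Πʳ v : HeightOneSpectrum (𝓞 F), [UnitaryGroup.localPi E c N J v, UnitaryGroup.localInt E c N J v])
        (h' : Πʳ v, [H v, KH v]),
      Commute (𝓢.OmegaPi g)
        ((𝓢.OmegaPi.comp (RestrictedProduct.mapAlongMonoidHom H (fun v => UnitaryGroup.localPi E c N J v) id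
          Filter.tendsto_id φ hφ)) h'))
    (χ : (Πʳ v, [H v, KH v]) →* ℂˣ)
    (hadmPi : (TwistedCoinv.rep χ 𝓢.OmegaPi hcomm).IsAdmissible)
    {W : Type*} [Group W] (ζ : W →* Πʳ v : HeightOneSpectrum (𝓞 F), [H v, KH v]) (hζ : Function.Surjective ζ)
    (hcW : ∀ (g : UnitaryGroup.finAdelic F E c N J) (w : W),
      Commute (𝓢.Omega g)
        ((show Representation ℂ W _ from
          (𝓢.OmegaPi.comp (RestrictedProduct.mapAlongMonoidHom H (fun v => UnitaryGroup.localPi E c N J v) id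
            Filter.tendsto_id φ hφ)).comp ζ) w)) :
    (TwistedCoinv.rep (χ.comp ζ) 𝓢.Omega hcW).IsAdmissible := by
  have hcζ : ∀ (g : Πʳ v : HeightOneSpectrum (𝓞 F), [UnitaryGroup.localPi E c N J v, UnitaryGroup.localInt E c N J v])
      (w : W), Commute (𝓢.OmegaPi g)
        ((show Representation ℂ W _ from
          (𝓢.OmegaPi.comp (RestrictedProduct.mapAlongMonoidHom H (fun v => UnitaryGroup.localPi E c N J v) id
            Filter.tendsto_id φ hφ)).comp ζ) w) := fun g w => hcomm g (ζ w)
  exact TwistedCoinv.isAdmissible_rep_comp_of_isOpenMap _ (χ.comp ζ) 𝓢.OmegaPi hcζ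
    (UnitaryGroup.finAdelicEquiv F E c N J).toMulEquiv.toMonoidHom (UnitaryGroup.finAdelicEquiv F E c N J).continuous
    (UnitaryGroup.finAdelicEquiv F E c N J).toHomeomorph.isOpenMap hcW
    ((TwistedCoinv.isAdmissible_rep_iff_of_comp_surjective_right _ χ ζ hζ 𝓢.OmegaPi hcomm hcζ).2 hadmPi)

end Literature.NumberTheory.GelbartRogawski1991.UnitaryDualPair.LocalSplitting.FinLocalSplittings

namespace Literature.NumberTheory.GelbartRogawski1991.UnitaryDualPair.WeilCoinv

variable (F E : Type) [Field F] [NumberField F] [Field E] [NumberField E] [Algebra F E]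
variable (c : E ≃ₐ[F] E) (N : ℕ) {n : ℕ} (e : Fin N × Fin 1 ≃ Fin n)
variable (JV : Matrix (Fin N) (Fin N) E) (JW : Matrix (Fin 1) (Fin 1) E)
variable {TV : Matrix (Fin N) (Fin N) F} {TW : Matrix (Fin 1) (Fin 1) F}
variable [Algebra.IsQuadraticExtension F E] {δ : E} (hcδ : c δ = -δ) (hδ : δ ≠ 0) {d : F}
  (hd : δ * δ = algebraMap F E d) (hV : TV.IsSymm) (hW : TW.IsSymm) (hVd : IsUnit TV.det) (hWd : IsUnit TW.det)
  (hJV : JV = TV.map (algebraMap F E)) (hJW : JW = TW.map (algebraMap F E)) (hJW0 : JW 0 0 ≠ 0)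
  (𝓢 : LocalSplitting.FinLocalSplittings F E c n hcδ hδ hd (gram F e TV TW) (isSymm_gram F e hV hW)
    (reindex_kronecker_eq_gram_map F E e hJV hJW))

-- as its irreducibility twin `omega_center_isIrreducible_of_local` (same file budget): the place-assembled centre
-- `Ω_Π ∘ Πʳ(localCenter)` is costly to elaborate against `Ω`'s restricted-product instances
set_option maxHeartbeats 800000 in
/-- **The `U(J_V)(𝔸_f)`-action on `Coinv(Ω ∘ (u ↦ u·1_n), χ₁)` is ADMISSIBLE once the `⊗′`-level central coinvariants
are** (line `W`; admissibility twin of `omega_center_isIrreducible_of_local`, its Flath step — `Coinv(Ω_Π ∘ Πʳ(localCenter),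
charOfCenter χ₁)` admissible, [Flath1979, §2 Example 2] — being the HYPOTHESIS `hadmPi`): the centre is `Πʳ(localCenter)`
place by place (`finAdelicEquiv_finAdelicCenter_eq_mapAlong`), `charOfCenter χ₁ ∘ ζ = χ₁` (`charOfCenter_comp`), so
`omega_centralCoinv_isAdmissible_of_omegaPi` gives admissibility under `U(J_{VW})(𝔸_f)` on the same coinvariant space
(`Submodule.quotEquivOfEq`), and for a line `U(J_{VW})(𝔸_f) = U(J_V)(𝔸_f) ⊗ 1` through the continuous OPEN embedding
`k ↦ reindex e e (k ⊗ₖ 1)` (`isOpenMap_finPairEmb_inl_of_line`).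
[cite: Liu2021, Def. 4.11 (l. 2092–2096), App. D §D.1 Step 3 (l. 5221); Flath1979, §2 Example 2] -/
theorem omega_center_isAdmissible_of_omegaPi {χ₁ : finAdelicOne F E c →* ℂˣ}
    (hcomm : ∀ (g : Πʳ v : HeightOneSpectrum (𝓞 F), [localPi E c n (Matrix.reindex e e (JV ⊗ₖ JW)) v,
        localInt E c n (Matrix.reindex e e (JV ⊗ₖ JW)) v])
      (h' : Πʳ v : HeightOneSpectrum (𝓞 F), [localPi E c 1 JW v, localInt E c 1 JW v]),
      Commute (𝓢.OmegaPi g)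
        ((𝓢.OmegaPi.comp (RestrictedProduct.mapAlongMonoidHom (fun v => localPi E c 1 JW v)
          (fun v => localPi E c n (Matrix.reindex e e (JV ⊗ₖ JW)) v) id Filter.tendsto_id
          (fun v => localCenter E c n (Matrix.reindex e e (JV ⊗ₖ JW)) JW hJW0 v)
          (Eventually.of_forall fun v =>
            localCenter_mapsTo_localInt E c n (Matrix.reindex e e (JV ⊗ₖ JW)) JW hJW0 v))) h'))
    (hadmPi : (TwistedCoinv.rep (charOfCenter F E c JW hJW0 χ₁) 𝓢.OmegaPi hcomm).IsAdmissible) :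
    (TwistedCoinv.rep χ₁
      (show Representation ℂ (finAdelic F E c N JV) _ from
        𝓢.Omega.comp ((finPairEmb F E c N 1 e JV JW).comp (MonoidHom.inl _ _)))
      (commute_omega_finPairEmb_finAdelicCenter F E c N e JV JW hcδ hδ hd hV hW hJV hJW 𝓢)).IsAdmissible := by
  -- the place-by-place centre `φ`, its integrality, the presentation `ζ : E¹(𝔸_f) ↠ Πʳ_v U(J_W)(F_v)`
  have hφ : ∀ᶠ v in cofinite, MapsTo (localCenter E c n (Matrix.reindex e e (JV ⊗ₖ JW)) JW hJW0 v)
      ((localInt E c 1 JW v : Subgroup (localPi E c 1 JW v)) : Set (localPi E c 1 JW v))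
      ((localInt E c n (Matrix.reindex e e (JV ⊗ₖ JW)) v : Subgroup (localPi E c n (Matrix.reindex e e (JV ⊗ₖ JW)) v)) :
        Set (localPi E c n (Matrix.reindex e e (JV ⊗ₖ JW)) v)) :=
    Eventually.of_forall fun v => localCenter_mapsTo_localInt E c n (Matrix.reindex e e (JV ⊗ₖ JW)) JW hJW0 v
  have hζ : Function.Surjective ((finAdelicEquiv F E c 1 JW).toMonoidHom.comp (finAdelicCenter F E c 1 JW)) :=
    finAdelicEquiv_comp_finAdelicCenter_surjective F E c JW hJW0
  -- the place-assembled action of the centre through `ζ`, ELABORATED ONCE (`ρZ`), IS `Ω ∘ (u ↦ u·1_n)`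
  set ρZ : Representation ℂ (finAdelicOne F E c) (FinSB F (Fin n)) :=
    (𝓢.OmegaPi.comp (RestrictedProduct.mapAlongMonoidHom (fun v => localPi E c 1 JW v)
      (fun v => localPi E c n (Matrix.reindex e e (JV ⊗ₖ JW)) v) id Filter.tendsto_id
      (fun v => localCenter E c n (Matrix.reindex e e (JV ⊗ₖ JW)) JW hJW0 v) hφ)).comp
      ((finAdelicEquiv F E c 1 JW).toMonoidHom.comp (finAdelicCenter F E c 1 JW))
  have hWop : ∀ u : finAdelicOne F E c, ρZ u = 𝓢.Omega (finAdelicCenter F E c n (Matrix.reindex e e (JV ⊗ₖ JW)) u) :=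
    fun u => LinearMap.ext fun f => by
      change 𝓢.OmegaPi _ f = _
      rw [LocalSplitting.FinLocalSplittings.Omega_apply,
        finAdelicEquiv_finAdelicCenter_eq_mapAlong F E c n (Matrix.reindex e e (JV ⊗ₖ JW)) JW hJW0 u]
      rfl
  have hcW : ∀ (g : finAdelic F E c n (Matrix.reindex e e (JV ⊗ₖ JW))) (u : finAdelicOne F E c),
      Commute (𝓢.Omega g) (ρZ u) := fun g u => by
    rw [hWop u]
    exact (show Commute g (finAdelicCenter F E c n (Matrix.reindex e e (JV ⊗ₖ JW)) u) from
      (finAdelicCenter_mul_comm F E c n _ u g).symm).map 𝓢.Omega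
  -- §A: `⊗′`-level admissibility read on the big group `U(J_{VW})(𝔸_f)`, the centre acting through `ζ`
  have hA : (TwistedCoinv.rep ((charOfCenter F E c JW hJW0 χ₁).comp
      ((finAdelicEquiv F E c 1 JW).toMonoidHom.comp (finAdelicCenter F E c 1 JW))) 𝓢.Omega hcW).IsAdmissible :=
    𝓢.omega_centralCoinv_isAdmissible_of_omegaPi
      (fun v => localCenter E c n (Matrix.reindex e e (JV ⊗ₖ JW)) JW hJW0 v) hφ hcomm (charOfCenter F E c JW hJW0 χ₁)
      hadmPi ((finAdelicEquiv F E c 1 JW).toMonoidHom.comp (finAdelicCenter F E c 1 JW)) hζ hcW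
  -- §B1: `charOfCenter χ₁ ∘ ζ = χ₁` and `ρZ = Ω ∘ centre`: the same coinvariant space
  have hχeq : (charOfCenter F E c JW hJW0 χ₁).comp
      ((finAdelicEquiv F E c 1 JW).toMonoidHom.comp (finAdelicCenter F E c 1 JW)) = χ₁ :=
    charOfCenter_comp F E c JW hJW0 χ₁
  have hc₁ : ∀ (g : finAdelic F E c n (Matrix.reindex e e (JV ⊗ₖ JW))) (u : finAdelicOne F E c),
      Commute (𝓢.Omega g) ((show Representation ℂ (finAdelicOne F E c) _ from
        𝓢.Omega.comp (finAdelicCenter F E c n (Matrix.reindex e e (JV ⊗ₖ JW)))) u) := fun g u =>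
    (show Commute g (finAdelicCenter F E c n (Matrix.reindex e e (JV ⊗ₖ JW)) u) from
      (finAdelicCenter_mul_comm F E c n _ u g).symm).map 𝓢.Omega
  have hker : TwistedCoinv.ker ρZ ((charOfCenter F E c JW hJW0 χ₁).comp
      ((finAdelicEquiv F E c 1 JW).toMonoidHom.comp (finAdelicCenter F E c 1 JW))) =
      TwistedCoinv.ker (show Representation ℂ (finAdelicOne F E c) _ from
        𝓢.Omega.comp (finAdelicCenter F E c n (Matrix.reindex e e (JV ⊗ₖ JW)))) χ₁ :=
    TwistedCoinv.ker_eq_of_forall_smul (fun _ => 1)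
      (fun u f => by rw [Units.val_one, one_smul]; exact LinearMap.congr_fun (hWop u) f)
      (fun u => by rw [one_mul]; exact DFunLike.congr_fun hχeq u)
  have hB : (TwistedCoinv.rep χ₁ 𝓢.Omega hc₁).IsAdmissible :=
    hA.of_equivariant (TwistedCoinv.rep χ₁ 𝓢.Omega hc₁) (Submodule.quotEquivOfEq _ _ hker) fun k x =>
      Submodule.Quotient.induction_on _ x fun v => rfl
  -- §B2: for a line, `U(J_{VW})(𝔸_f) = U(J_V)(𝔸_f) ⊗ 1` through a continuous OPEN embedding
  exact TwistedCoinv.isAdmissible_rep_comp_of_isOpenMap _ χ₁ 𝓢.Omega hc₁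
    ((finPairEmb F E c N 1 e JV JW).comp (MonoidHom.inl _ _)) (continuous_finPairEmb_inl F E c N e JV JW)
    (isOpenMap_finPairEmb_inl_of_line F E c N e JV JW hJW0)
    (commute_omega_finPairEmb_finAdelicCenter F E c N e JV JW hcδ hδ hd hV hW hJV hJW 𝓢) hB

variable {s : UnitaryGroup.adelicPair F E c N 1 JV JW →* adelicMpCont F (Fin n) (adelicGram F e TV TW)}
  (hs : (splittingDatum F E c N 1 e JV JW hcδ hδ hd hV hW hVd hWd hJV hJW).IsCompatible s)

include hJW0 in
/-- **`Ω(s, χ')` is ADMISSIBLE once the `U(J_V)(𝔸_f)`-action on «the maximal quotient of `Ω` on which the CENTRE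
`E¹(𝔸_{F,f})` acts by `χ₁ = χ' ∘ (u ↦ u·1_W)`» is** — line `W`, compatible splitting `s` FACTORING through the local
reference section of `𝓢` (`hfac`, no twist), any character `χ'` of `U(J_W)(𝔸_f)`; admissibility twin of (one direction of)
`isIrreducible_weilCoinv_iff_omega_center`: `Ω(s, χ') ≃ Coinv(ω_f^{s₀}|_{U(J_W)}, χ')` equivariantly
(`exists_weilCoinv_equiv_reference`, twist `1`), `≃` the `χ'`-coinvariants of `u ↦ Ω(reindex (1 ⊗ u))` along
`R_e = finSBReindex F e` (`TwistedCoinv.isAdmissible_rep_iff_of_mapEquiv`), whose relation submodule is that of the centre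
acting through `Ω ∘ finAdelicCenter` (`finPairEmb_one_finAdelicCenter`, `finAdelicCenter_surjective_one`).
[cite: Liu2021, Def. 4.11 (l. 2092–2096), App. D §D.1 Step 3 (l. 5221); GelbartRogawski1991, §3.1 Prop. 3.1.1 p. 455 L1–3, Remark p. 457 L4–13] -/
theorem isAdmissible_weilCoinv_of_omega_center
    (hfac : (pairSmall₁ F E c N 1 e JV JW s).comp (finPairToAdelic F E c N 1 JV JW) =
      localRefSection F E c N 1 e JV JW hcδ hδ hd hV hW hJV hJW 𝓢)
    (χ' : UnitaryGroup.finAdelic F E c 1 JW →* ℂˣ) {χ₁ : finAdelicOne F E c →* ℂˣ}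
    (hχ₁ : χ'.comp (UnitaryGroup.finAdelicCenter F E c 1 JW) = χ₁)
    (h : (TwistedCoinv.rep χ₁
      (show Representation ℂ (finAdelic F E c N JV) _ from
        𝓢.Omega.comp ((finPairEmb F E c N 1 e JV JW).comp (MonoidHom.inl _ _)))
      (commute_omega_finPairEmb_finAdelicCenter F E c N e JV JW hcδ hδ hd hV hW hJV hJW 𝓢)).IsAdmissible) :
    (weilCoinv F E c N 1 e JV JW hcδ hδ hd hV hW hVd hWd hJV hJW χ' hs).IsAdmissible := by
  subst hχ₁
  -- the twist against the local reference section is `1`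
  have hχ : (pairSmall₁ F E c N 1 e JV JW s).comp (finPairToAdelic F E c N 1 JV JW) =
      adelicMpCont.twist F (Fin N × Fin 1) _ (localRefSection F E c N 1 e JV JW hcδ hδ hd hV hW hJV hJW 𝓢)
        (1 : UnitaryGroup.finAdelic F E c N JV × UnitaryGroup.finAdelic F E c 1 JW →* ℂˣ) :=
    hfac.trans (MonoidHom.ext fun h => (adelicMpCont.twist_eq_of_eq_one _ (1 : _ →* ℂˣ) rfl).symm)
  have hχ' : ∀ u, χ' u = (1 : UnitaryGroup.finAdelic F E c N JV × UnitaryGroup.finAdelic F E c 1 JW →* ℂˣ) (1, u) * χ' u :=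
    fun u => by rw [MonoidHom.one_apply, one_mul]
  -- (E3) pull the acting group back along the surjection `u ↦ u·1_W : E¹(𝔸_f) ↠ U(J_W)(𝔸_f)`: same relation submodule
  have hWrep : (show Representation ℂ (UnitaryGroup.finAdelicOne F E c) _ from
      (show Representation ℂ (UnitaryGroup.finAdelic F E c 1 JW) _ from
        𝓢.Omega.comp ((finPairEmb F E c N 1 e JV JW).comp (MonoidHom.inr _ _))).comp
          (UnitaryGroup.finAdelicCenter F E c 1 JW)) =
      (show Representation ℂ (UnitaryGroup.finAdelicOne F E c) _ from
        𝓢.Omega.comp (UnitaryGroup.finAdelicCenter F E c n (Matrix.reindex e e (JV ⊗ₖ JW)))) := by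
    refine MonoidHom.ext fun u => ?_
    change 𝓢.Omega (finPairEmb F E c N 1 e JV JW (1, UnitaryGroup.finAdelicCenter F E c 1 JW u)) =
      𝓢.Omega (UnitaryGroup.finAdelicCenter F E c n (Matrix.reindex e e (JV ⊗ₖ JW)) u)
    rw [finPairEmb_one_finAdelicCenter]
  have h3 : (TwistedCoinv.rep χ'
      (show Representation ℂ (UnitaryGroup.finAdelic F E c N JV) _ from
        𝓢.Omega.comp ((finPairEmb F E c N 1 e JV JW).comp (MonoidHom.inl _ _)))
      (commute_omega_finPairEmb F E c N 1 e JV JW hcδ hδ hd hV hW hJV hJW 𝓢)).IsAdmissible := by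
    rw [← TwistedCoinv.isAdmissible_rep_iff_of_comp_surjective_right _ χ' (UnitaryGroup.finAdelicCenter F E c 1 JW)
      (UnitaryGroup.finAdelicCenter_surjective_one F E c JW hJW0) _
      (commute_omega_finPairEmb F E c N 1 e JV JW hcδ hδ hd hV hW hJV hJW 𝓢)
      (fun k u => by
        rw [hWrep]
        exact commute_omega_finPairEmb_finAdelicCenter F E c N e JV JW hcδ hδ hd hV hW hJV hJW 𝓢 k u)]
    -- the two coinvariant spaces are the quotients by the same submodule (`hWrep`)
    refine h.of_equivariant _ (Submodule.quotEquivOfEq _ _ (by rw [hWrep])) fun k x => ?_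
    obtain ⟨v, rfl⟩ := TwistedCoinv.mk_surjective _ _ x
    rfl
  -- (E2) transport along `R_e = finSBReindex F e` to the reference section `s₀ = localRefSection 𝓢`
  have h2 : (TwistedCoinv.rep χ'
      ((finRepMp (isUnit_kronecker_map F N hVd hWd) (localRefSection F E c N 1 e JV JW hcδ hδ hd hV hW hJV hJW 𝓢)
        (harch_localRefSection F E c N 1 e JV JW hcδ hδ hd hV hW hVd hWd hJV hJW 𝓢 hs)).comp (MonoidHom.inl _ _))
      (commute_comp_inl_comp_inr _)).IsAdmissible := by
    refine (TwistedCoinv.isAdmissible_rep_iff_of_mapEquiv _ χ' _ χ' _ _ _ _ (finSBReindex F e) (fun _ => 1)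
      (fun u f => ?_) (fun u => (one_mul _).symm) (fun k f => ?_)).2 h3
    · -- `Ω(reindex (1 ⊗ u)) (R_e f) = R_e (ω_f^{s₀}(1, u) f)`
      rw [Units.val_one, one_smul]
      change 𝓢.Omega (finPairEmb F E c N 1 e JV JW (1, u)) (finSBReindex F e f) =
        finSBReindex F e (finRepMp (isUnit_kronecker_map F N hVd hWd) (localRefSection F E c N 1 e JV JW hcδ hδ hd hV hW hJV hJW 𝓢)
          (harch_localRefSection F E c N 1 e JV JW hcδ hδ hd hV hW hVd hWd hJV hJW 𝓢 hs) (1, u) f)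
      rw [finRepMp_localRefSection_apply F E c N 1 e JV JW hcδ hδ hd hV hW hVd hWd hJV hJW 𝓢 hs, LinearEquiv.apply_symm_apply]
    · change 𝓢.Omega (finPairEmb F E c N 1 e JV JW (k, 1)) (finSBReindex F e f) =
        finSBReindex F e (finRepMp (isUnit_kronecker_map F N hVd hWd) (localRefSection F E c N 1 e JV JW hcδ hδ hd hV hW hJV hJW 𝓢)
          (harch_localRefSection F E c N 1 e JV JW hcδ hδ hd hV hW hVd hWd hJV hJW 𝓢 hs) (k, 1) f)
      rw [finRepMp_localRefSection_apply F E c N 1 e JV JW hcδ hδ hd hV hW hVd hWd hJV hJW 𝓢 hs, LinearEquiv.apply_symm_apply]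
  -- (E1) `Ω(s, χ') ≃ Coinv(ω_f^{s₀}|_{U(J_W)}, χ')`, equivariant (twist `1`)
  obtain ⟨T, -, hT⟩ := exists_weilCoinv_equiv_reference F E c N 1 e JV JW hcδ hδ hd hV hW hVd hWd hJV hJW
    (proj_localRefSection_eq F E c N 1 e JV JW hcδ hδ hd hV hW hVd hWd hJV hJW 𝓢 hs) hχ hs hχ'
  exact (Representation.isAdmissible_iff_of_equivariant (weilCoinv F E c N 1 e JV JW hcδ hδ hd hV hW hVd hWd hJV hJW χ' hs)
    (TwistedCoinv.rep χ'
      ((finRepMp (isUnit_kronecker_map F N hVd hWd) (localRefSection F E c N 1 e JV JW hcδ hδ hd hV hW hJV hJW 𝓢)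
        (harch_localRefSection F E c N 1 e JV JW hcδ hδ hd hV hW hVd hWd hJV hJW 𝓢 hs)).comp (MonoidHom.inl _ _))
      (commute_comp_inl_comp_inr _)) T fun k x => by
    simpa only [MonoidHom.one_apply, Units.val_one, one_smul] using hT k x).2 h2

end Literature.NumberTheory.GelbartRogawski1991.UnitaryDualPair.WeilCoinv

end
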